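import Literature.NumberTheory.Automorphic.ReciprocityGLnPotentialModularity
import Literature.NumberTheory.Automorphic.Sweep1PotentialModularitySolubleDescent
import Literature.NumberTheory.Automorphic.Sweep1PotentialModularityGoodReductionProofs
import Literature.NumberTheory.EllipticCurves.HasseWeilGoodReductionProofs
import Literature.NumberTheory.EllipticCurves.MinimalModelReduction
import Literature.NumberTheory.DiophantineGeometry.LocalReductionIsIntegralAtProofs
import HarnessLib

/-!
# Potential modularity of elliptic curves over CM fields (lang.S28, `ReciprocityGLn` form) from
# the Galois-side transcription with soluble descent

`Proofs` companion (theorems only, no definitions, no named facts) of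
`Literature.NumberTheory.Automorphic.ReciprocityGLnPotentialModularity` for the named fact
`Literature.NumberTheory.Automorphic.potentiallyModular_ellipticCurve_CM` (**lang.S28**; P. B. Allen,
F. Calegari, A. Caraiani, T. Gee, D. Helm, B. V. Le Hung, J. Newton, P. Scholze, R. Taylor,
J. A. Thorne, *Potential automorphy over CM fields*, Ann. of Math. (2) 197 (2023), 897–1113,
Thm. 1.0.1 for a non-CM `E`, via Cor. 7.1.12 for `m = 1` and `R = R_E`).

The tree carries the source's Cor. 7.1.12 for `R_E` as exactly one named fact stated on the
carrier `CuspidalAutomorphicRepData 2 K hK` of the target: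
`Literature.NumberTheory.Automorphic.exists_isCMField_forall_isSolvable_isTateAutomorphic`
(`Sweep1PotentialModularitySolubleDescent`; Cor. 7.1.12 with Prop. 6.5.13 (2), the strong form with
soluble descent requested by the route `AnalyticDescent`), whose conclusion
`WeierstrassCurve.IsCuspidalTateAutomorphic` contains a weight-zero cuspidal `π` with
`∏_{z ∈ α} (X - q_v^{1/2} z) = X² - a X + q_v` **and** the Galois clause
`WeierstrassCurve.HasTateFrobPolyAt W v a` (every arithmetic Frobenius at `v` has characteristic
polynomial `X² - a X + q_v` on `V_ℓ E`, `v ∤ ℓ`) at almost all `v` — with the integer `a` tied to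
the Tate module, not to a point count.  The target instead reads `a_w = q_w + 1 - #E(k_w)` off the
reduction modulo `w` of the *given* integral model (`frobTraceAt`).  This file proves the missing
elliptic-curve bridge and the reduction:

* `frobeniusTraceAt_baseChange_eq_frobTraceAt` (**proved**): for an integral model `E / 𝓞 L` and
  a place `w ∤ Δ(E)`, the trace of Frobenius `a_w` of `E ⊗ L` in the sense of Mathlib's
  `WeierstrassCurve.localPolynomial` (`WeierstrassCurve.frobeniusTraceAt`: point count of the
  reduction of Mathlib's *chosen* minimal model of `E ⊗ L_w`) is `frobTraceAt E w` (point count of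
  `E mod w`): the given equation over `L_w` is integral with unit discriminant, hence minimal with
  good reduction (Silverman VII.1.1, VII.5.1(a): `hasGoodReduction_baseChange_of_valuation_Δ_eq_one`);
  two minimal equations have reductions with the same number of points (Silverman VII.1.3(b),
  `natCard_point_reduction_minimal` of `MinimalModelReduction`); and the reduction of `E ⊗ 𝒪_w` is
  `E mod w` transported along `𝓞 L ⧸ w ≃ k_w` (`residueFieldEquiv`).
* `eq_frobTraceAt_of_hasTateFrobPolyAt` (**proved**): if `V_ℓ(E ⊗ L)` has Frobenius polynomial
  `X² - a X + q_w` at a place `w ∤ ℓ Δ(E)` then `a = frobTraceAt E w` — by Silverman C.21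
  Remark 21.3 as proved in the tree (`hasFrobCharpolyAt_rationalTateGaloisRepOf_of_hasGoodReductionAt`
  with `trace/det_galoisRepTate_frobenius_of_hasGoodReductionAt_holds`: the Weil pairing, the
  reduction isomorphism `T_ℓ E ≅ T_ℓ Ẽ_w` and Thm. V.2.3.1, all theorems of the tree), the
  witnesses `continuous_rationalGaloisRepTate_holds`, `module_finite_rationalTateModule_holds`, and
  a Frobenius element at `w` (`exists_isArithFrobAt_of_mem_primesAbove_holds`).
* `exists_hasWeightZero_frobTraceAt_of_isCuspidalTateAutomorphic` (**proved**): if `E ⊗ L` is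
  cuspidal-Tate-automorphic then the conclusion of `potentiallyModular_ellipticCurve_CM` holds for
  `E / 𝓞 L` over `L` itself (at `ℓ = 2`, discarding the finitely many `w ∣ 2 Δ(E)`).
* `potentiallyModular_ellipticCurve_CM_of_isCuspidalTateAutomorphic` (**proved**): the printed
  Cor. 7.1.12 for `R_E`, `m = 1`, read as "over some finite CM extension `L/K`, `E ⊗ L` is
  cuspidal-Tate-automorphic" (explicit hypothesis, Galois form on the target's carrier), implies
  the accepted `potentiallyModular_ellipticCurve_CM`.
* `potentiallyModular_ellipticCurve_CM_of_forall_isSolvable_isTateAutomorphic` (**proved**):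
  **`exists_isCMField_forall_isSolvable_isTateAutomorphic → potentiallyModular_ellipticCurve_CM`**
  (take the soluble-index subfield `K = F'`).

Net effect for lang.S28: the three accepted transcriptions of the source
(`potentiallyModular_ellipticCurve_CM`, `exists_isCMField_isTateAutomorphic` →
`exists_isCMField_isModular`) all follow from the single named fact
`exists_isCMField_forall_isSolvable_isTateAutomorphic`; the whole elliptic-curve side is proved.
Nothing here is new mathematics: the source reads Thm. 1.0.1 off Cor. 7.1.12 in one sentence
("`R_E` is a strongly irreducible rank-2 very weakly compatible system with `Q_v = X² - a_v X + q_v`,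
`a_v = q_v + 1 - #Ẽ(k_v)`"), and that sentence is Silverman V.2.3.1 + VII.4.1 + C.§16, formalised
in `EllipticCurves/HasseWeilGoodReduction*` and assembled here for an arbitrary integral model.

## References

* P. B. Allen, F. Calegari, A. Caraiani, T. Gee, D. Helm, B. V. Le Hung, J. Newton, P. Scholze,
  R. Taylor, J. A. Thorne, *Potential automorphy over CM fields*, Ann. of Math. (2) 197 (2023),
  897–1113 (held: `lit:arxiv-1812.09999`): Thm. 1.0.1, §7.1 (automorphic compatible systems,
  `R_E`), Cor. 7.1.12, Prop. 6.5.13. [ACCGHLNSTT2023] = [AllenCalegariCaraianiGeeEtAl2023]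
* J. H. Silverman, *The Arithmetic of Elliptic Curves*, 2nd ed., GTM 106 (2009): Rem. VII.1.1,
  Prop. VII.1.3(b), §VII.2, Prop. VII.4.1, Prop. VII.5.1(a), Thm. V.2.3.1, C.§16, C.21
  Remark 21.3. [SilvermanAEC2009]

## Design notes

* Pure-proof leaf file: imports the two lang.S28 decomposition files of `Automorphic/` and the
  elliptic-curve proofs; nothing imports it; no definitions, no instances, no `sorry`.
* The auxiliary prime is `ℓ = 2` (any prime works; the places above `ℓ` are discarded by
  `eventually_natCast_not_mem_asIdeal`).
* `(E ⊗ K) ⊗ L = (E ⊗ 𝓞 L) ⊗ L` (`baseChange_baseChange_eq_baseChange_ringOfIntegers`) moves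
  between the field-valued curve fed to the named fact and the integral model read by the target.
* Universe `0` number fields, as the target and `CuspidalAutomorphicRepData` require.
-/

noncomputable section

open scoped MatrixGroups Polynomial NumberField Classical
open NumberField IsDedekindDomain Filter Polynomial WeierstrassCurve

namespace Literature.NumberTheory.Automorphic

/-! ### Base change of an integral model along `𝓞 K → K → L` and `𝓞 K → 𝓞 L → L` -/

section Models

variable {K : Type} [Field K]

/-- `(E ⊗ K) ⊗ L = (E ⊗ 𝓞 L) ⊗ L` for an integral model `E / 𝓞 K` and an extension `L / K`:
both are `E` mapped along `𝓞 K → L` (Mathlib `IsScalarTower (𝓞 K) K L`,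
`IsScalarTower (𝓞 K) (𝓞 L) L`). [folklore] -/
theorem baseChange_baseChange_eq_baseChange_ringOfIntegers (E : WeierstrassCurve (𝓞 K))
    (L : Type) [Field L] [Algebra K L] :
    (E.baseChange K).baseChange L = (E.baseChange (𝓞 L)).baseChange L := by
  simp only [WeierstrassCurve.baseChange, WeierstrassCurve.map_map]
  rw [← IsScalarTower.algebraMap_eq (𝓞 K) K L, ← IsScalarTower.algebraMap_eq (𝓞 K) (𝓞 L) L]

end Models

/-! ### The given integral model at a place `w ∤ Δ`: minimal, good reduction, `a_w = q_w + 1 - #E(k_w)` -/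

section IntegralModel

variable {L : Type} [Field L] [NumberField L]

/-- For an integral model `E / 𝓞 L` and a finite place `w` with `Δ(E) ∉ w`, the discriminant of
`E ⊗ L` is a `w`-adic unit: `w(Δ) = 1` (Mathlib `valuation_eq_one_iff_notMem`). [folklore] -/
theorem valuation_Δ_baseChange_eq_one {E : WeierstrassCurve (𝓞 L)} {w : HeightOneSpectrum (𝓞 L)}
    (hw : E.Δ ∉ w.asIdeal) : w.valuation L (E.baseChange L).Δ = 1 := by
  rw [WeierstrassCurve.baseChange, WeierstrassCurve.map_Δ,
    HeightOneSpectrum.valuation_eq_one_iff_notMem]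
  exact hw

/-- An integral model with `w ∤ Δ` has good reduction at `w` (`HasGoodReductionAt`: Mathlib's
chosen minimal model of `E ⊗ L_w` has unit discriminant); Silverman, *AEC*, Rem. VII.1.1 and
Prop. VII.5.1(a), in the tree `hasGoodReductionAt_of_valuation_Δ_eq_one_holds` with
`isIntegralAt_baseChange`. [cite: SilvermanAEC2009, Rem. VII.1.1 and Prop. VII.5.1(a)] -/
theorem hasGoodReductionAt_baseChange_of_Δ_not_mem {E : WeierstrassCurve (𝓞 L)}
    {w : HeightOneSpectrum (𝓞 L)} (hw : E.Δ ∉ w.asIdeal) :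
    (E.baseChange L).HasGoodReductionAt w :=
  hasGoodReductionAt_of_valuation_Δ_eq_one_holds w (E.baseChange L) (isIntegralAt_baseChange w E)
    (valuation_Δ_baseChange_eq_one hw)

/-- An integral model with `w ∤ Δ`, base-changed to the completion `L_w`, is itself a minimal
equation with good reduction in Mathlib's sense (`WeierstrassCurve.HasGoodReduction` over `𝒪_w`);
Silverman, *AEC*, Rem. VII.1.1 ("if `v(Δ) < 12` the equation is minimal") and Prop. VII.5.1(a),
in the tree `hasGoodReduction_baseChange_of_valuation_Δ_eq_one`.
[cite: SilvermanAEC2009, Rem. VII.1.1 and Prop. VII.5.1(a)] -/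
theorem hasGoodReduction_baseChange_adicCompletion_of_Δ_not_mem {E : WeierstrassCurve (𝓞 L)}
    {w : HeightOneSpectrum (𝓞 L)} (hw : E.Δ ∉ w.asIdeal) :
    ((E.baseChange L).baseChange (w.adicCompletion L)).HasGoodReduction
      (w.adicCompletionIntegers L) :=
  (E.baseChange L).hasGoodReduction_baseChange_of_valuation_Δ_eq_one w (isIntegralAt_baseChange w E)
    (valuation_Δ_baseChange_eq_one hw)

/-- The `𝒪_w`-integral model of `E ⊗ L_w` (Mathlib `integralModel`, unique by injectivity of
`𝒪_w → L_w`) is `E ⊗ 𝒪_w`. [folklore] -/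
theorem integralModel_baseChange_adicCompletion_eq (E : WeierstrassCurve (𝓞 L))
    (w : HeightOneSpectrum (𝓞 L))
    [((E.baseChange L).baseChange (w.adicCompletion L)).IsIntegral (w.adicCompletionIntegers L)] :
    ((E.baseChange L).baseChange (w.adicCompletion L)).integralModel (w.adicCompletionIntegers L) =
      E.map (algebraMap (𝓞 L) (w.adicCompletionIntegers L)) :=
  integralModel_eq_of_baseChange_eq _ _ <| by
    simp only [WeierstrassCurve.baseChange, WeierstrassCurve.map_map]
    -- the two composites `𝓞 L → 𝒪_w → L_w` and `𝓞 L → L → L_w` agree elementwise (by `rfl`)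
    exact congrArg E.map (RingHom.ext fun r => rfl)

/-- **`#Ẽ_w(k_w) = #E(𝓞 L ⧸ w)` at a place `w ∤ Δ(E)` of an integral model.**  The number of
points of the reduction `Ẽ_w` of Mathlib's chosen minimal model of `E ⊗ L_w` (the curve counted by
`WeierstrassCurve.localPolynomial`, `reductionAt`) equals the number of points of `E mod w`
(`numPointsResidue`): the given equation over `L_w` is minimal
(`hasGoodReduction_baseChange_adicCompletion_of_Δ_not_mem`), two minimal equations have
reductions with equally many points (Silverman, *AEC*, Prop. VII.1.3(b) and §VII.2,
`natCard_point_reduction_minimal`), its reduction is `E ⊗ 𝒪_w mod 𝔪_w`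
(`integralModel_baseChange_adicCompletion_eq`), i.e. `E mod w` mapped along the isomorphism
`𝓞 L ⧸ w ≃ k_w` (`residueFieldEquiv`, `natCard_point_map_ringEquiv`).
[cite: SilvermanAEC2009, Prop. VII.1.3(b) and §VII.2] -/
theorem natCard_point_reductionAt_baseChange_eq_numPointsResidue {E : WeierstrassCurve (𝓞 L)}
    {w : HeightOneSpectrum (𝓞 L)} (hw : E.Δ ∉ w.asIdeal) :
    Nat.card ((E.baseChange L).reductionAt w).toAffine.Point = numPointsResidue E w := by
  set R := w.adicCompletionIntegers L with hR
  set X : WeierstrassCurve (w.adicCompletion L) :=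
    (E.baseChange L).baseChange (w.adicCompletion L) with hX
  have hgood : X.HasGoodReduction R := hasGoodReduction_baseChange_adicCompletion_of_Δ_not_mem hw
  haveI : X.IsMinimal R := hgood.toIsMinimal
  have hΔE : (E.baseChange L).Δ ≠ 0 := by
    rw [WeierstrassCurve.baseChange, WeierstrassCurve.map_Δ]
    exact RingOfIntegers.coe_ne_zero_iff.mpr fun h => hw (by rw [h]; exact w.asIdeal.zero_mem)
  have hΔX : X.Δ ≠ 0 := by
    rw [hX, WeierstrassCurve.baseChange, WeierstrassCurve.map_Δ]
    exact (map_ne_zero_iff _ (algebraMap L (w.adicCompletion L)).injective).mpr hΔE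
  -- Mathlib's chosen minimal model and the given (minimal) equation: same number of points
  have h1 : Nat.card ((E.baseChange L).reductionAt w).toAffine.Point =
      Nat.card (X.reduction R).toAffine.Point :=
    natCard_point_reduction_minimal X hΔX
  -- the reduction of the given equation is `E mod w`, transported along `𝓞 L ⧸ w ≃ k_w`
  have h2 : X.reduction R =
      (E.map (Ideal.Quotient.mk w.asIdeal)).map
        (HeightOneSpectrum.residueFieldEquiv L w : 𝓞 L ⧸ w.asIdeal →+* IsLocalRing.ResidueField R) := by
    rw [WeierstrassCurve.reduction, integralModel_baseChange_adicCompletion_eq E w,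
      WeierstrassCurve.map_map, WeierstrassCurve.map_map]
    -- `residueFieldEquiv ∘ (mod w) = residue ∘ (𝓞 L → 𝒪_w)` holds by `rfl` on representatives
    congr 1
  rw [h1, h2, natCard_point_map_ringEquiv]
  rfl

/-- **`a_w(E ⊗ L) = q_w + 1 - #E(k_w)` for the given integral model at `w ∤ Δ(E)`**: the trace of
Frobenius of `E ⊗ L` at `w` in the sense of Mathlib's `localPolynomial`
(`WeierstrassCurve.frobeniusTraceAt`, read off the chosen minimal model) is `frobTraceAt E w`
(read off `E mod w`); `q_w = #k_w` by `natCard_residueField_eq_residueCard`.  Silverman, *AEC*,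
C.§16 (`a_v = q_v + 1 - #Ẽ(k_v)`, independent of the minimal equation by VII.1.3(b)).
[cite: SilvermanAEC2009, C.§16 with Prop. VII.1.3(b)] -/
theorem frobeniusTraceAt_baseChange_eq_frobTraceAt {E : WeierstrassCurve (𝓞 L)}
    {w : HeightOneSpectrum (𝓞 L)} (hw : E.Δ ∉ w.asIdeal) :
    (E.baseChange L).frobeniusTraceAt w = frobTraceAt E w := by
  rw [WeierstrassCurve.frobeniusTraceAt_def, natCard_residueField_eq_residueCard,
    natCard_point_reductionAt_baseChange_eq_numPointsResidue hw]
  rfl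

/-- **From the Frobenius polynomial of `V_ℓ E` to the point count.**  Let `E / 𝓞 L` be an integral
model, `w` a finite place with `w ∤ Δ(E)` and `w ∤ ℓ`.  If every arithmetic Frobenius at `w` has
characteristic polynomial `X² - a X + q_w` on `V_ℓ(E ⊗ L)` (`HasTateFrobPolyAt`, for all
continuity / finiteness witnesses), then `a = a_w(E) = q_w + 1 - #E(k_w)` (`frobTraceAt`).  Proof:
instantiate at the witnesses `continuous_rationalGaloisRepTate_holds`,
`module_finite_rationalTateModule_holds`; by Silverman C.21 Remark 21.3 as proved in the tree
(`hasFrobCharpolyAt_rationalTateGaloisRepOf_of_hasGoodReductionAt` with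
`trace_galoisRepTate_frobenius_of_hasGoodReductionAt_holds`,
`det_galoisRepTate_frobenius_of_hasGoodReductionAt_holds`) the same Frobenii have characteristic
polynomial `X² - a_w X + q_w`; a Frobenius at `w` exists (`primesAbove_nonempty`,
`exists_isArithFrobAt_of_mem_primesAbove_holds`), so the two polynomials coincide and `a = a_w`,
which is `frobTraceAt E w` (`frobeniusTraceAt_baseChange_eq_frobTraceAt`).
[cite: SilvermanAEC2009, C.21 Remark 21.3 and C.§16] -/
theorem eq_frobTraceAt_of_hasTateFrobPolyAt {E : WeierstrassCurve (𝓞 L)}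
    {w : HeightOneSpectrum (𝓞 L)} (hw : E.Δ ∉ w.asIdeal) {ℓ : ℕ} [Fact ℓ.Prime]
    (hℓ : (ℓ : 𝓞 L) ∉ w.asIdeal) {a : ℤ} (ha : (E.baseChange L).HasTateFrobPolyAt w a) :
    a = frobTraceAt E w := by
  set W : WeierstrassCurve L := E.baseChange L with hWdef
  haveI : W.IsElliptic := (hasGoodReductionAt_baseChange_of_Δ_not_mem hw).isElliptic
  haveI hfin : Module.Finite ℚ_[ℓ] (W.rationalTateModule ℓ) :=
    W.module_finite_rationalTateModule_holds ℓ
  have hc : Continuous fun x : Field.absoluteGaloisGroup L × W.rationalTateModule ℓ =>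
      EllipticCurves.rationalTateRepresentation (Field.absoluteGaloisGroup L)
        (WeierstrassCurve.geomPoints W) ℓ x.1 x.2 :=
    W.continuous_rationalGaloisRepTate_holds ℓ
  obtain ⟨-, hFrob⟩ := ha ℓ hℓ hc hfin
  have hFrob' := hasFrobCharpolyAt_rationalTateGaloisRepOf_of_hasGoodReductionAt
    (W.trace_galoisRepTate_frobenius_of_hasGoodReductionAt_holds ℓ)
    (W.det_galoisRepTate_frobenius_of_hasGoodReductionAt_holds ℓ) hc hℓ
    (hasGoodReductionAt_baseChange_of_Δ_not_mem hw)
  obtain ⟨𝔓, h𝔓⟩ := HeightOneSpectrum.primesAbove_nonempty w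
  obtain ⟨σ, hσ⟩ := HeightOneSpectrum.exists_isArithFrobAt_of_mem_primesAbove_holds h𝔓
  have hPQ := (hFrob 𝔓 h𝔓 σ hσ).symm.trans (hFrob' 𝔓 h𝔓 σ hσ)
  have hL : (frobPoly a w.residueCard).map (Int.castRingHom ℚ_[ℓ]) =
      X ^ 2 - C (a : ℚ_[ℓ]) * X + C ((w.residueCard : ℕ) : ℚ_[ℓ]) := by
    simp [frobPoly, Polynomial.map_sub, Polynomial.map_add, Polynomial.map_mul,
      Polynomial.map_pow]
  rw [hL] at hPQ
  obtain ⟨hsum, -⟩ := coeff_quadratic_eq hPQ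
  have haw : a = W.frobeniusTraceAt w := by exact_mod_cast hsum
  rw [haw, hWdef, frobeniusTraceAt_baseChange_eq_frobTraceAt hw]

end IntegralModel

/-! ### lang.S28 (`ReciprocityGLn` form) from cuspidal Tate-automorphy -/

section Assembly

/-- **Pointwise reduction.**  Let `E / 𝓞 L` be an integral model with `Δ(E) ≠ 0` whose generic
fibre `E ⊗ L` is cuspidal-Tate-automorphic (`WeierstrassCurve.IsCuspidalTateAutomorphic`: the
compatible system `R_{E_L}` is automorphic in the sense of the source, §7.1, by a weight-zero
cuspidal `π` on the Borel–Jacquet carrier, together with the Galois clause `HasTateFrobPolyAt`).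
Then the conclusion of `potentiallyModular_ellipticCurve_CM` holds for `E` over `L` itself: the
same `π`, and at the cofinitely many places `w ∤ 2 Δ(E)` (`eventually_not_mem_asIdeal`,
`eventually_natCast_not_mem_asIdeal`) the Satake parameter `α = {α₁, α₂}` satisfies
`q_w^{1/2}(α₁ + α₂) = a = a_w(E)` (`coeff_quadratic_eq` on `∏ (X - q_w^{1/2} α_j) = X² - a X + q_w`,
and `eq_frobTraceAt_of_hasTateFrobPolyAt` at `ℓ = 2`).  Source §7.1 (definition of an automorphic
compatible system, for `R = R_E` with `Q_v = X² - a_v X + q_v`, `a_v = q_v + 1 - #Ẽ(k_v)`).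
[cite: ACCGHLNSTT2023, §7.1 (R_E) with Cor. 7.1.12 (m = 1)] -/
theorem exists_hasWeightZero_frobTraceAt_of_isCuspidalTateAutomorphic {L : Type} [Field L]
    [NumberField L] {E : WeierstrassCurve (𝓞 L)} (hΔ : E.Δ ≠ 0)
    (hA : (E.baseChange L).IsCuspidalTateAutomorphic) :
    ∃ (hL : isCompact_glFiniteIntegralLevel 2 L) (π : CuspidalAutomorphicRepData 2 L hL),
      π.1.HasWeightZero ∧
        ∀ᶠ w : HeightOneSpectrum (𝓞 L) in cofinite, ∃ α : Multiset ℂ,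
          π.1.HasSatakeParamAt w α ∧
            ((Real.sqrt w.residueCard : ℝ) : ℂ) * α.sum = (frobTraceAt E w : ℂ) := by
  obtain ⟨hL, π, h0, hev⟩ := hA.exists_hasWeightZero
  refine ⟨hL, π, h0, ?_⟩
  filter_upwards [hev, eventually_not_mem_asIdeal hΔ,
    eventually_natCast_not_mem_asIdeal L (two_ne_zero : (2 : ℕ) ≠ 0)] with w hw hwΔ hw2
  obtain ⟨α, a, hSat, hpoly, hTate⟩ := hw
  have ha : a = frobTraceAt E w := eq_frobTraceAt_of_hasTateFrobPolyAt (ℓ := 2) hwΔ hw2 hTate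
  refine ⟨α, hSat, ?_⟩
  obtain ⟨z₁, z₂, rfl⟩ := Multiset.card_eq_two.1 hSat.card_eq
  set c : ℂ := ((Real.sqrt (w.residueCard : ℝ) : ℝ) : ℂ) with hc_def
  have hpoly' : (X : ℂ[X]) ^ 2 - C (c * z₁ + c * z₂) * X + C (c * z₁ * (c * z₂)) =
      X ^ 2 - C (a : ℂ) * X + C ((w.residueCard : ℕ) : ℂ) := by
    rw [← X_sub_C_mul_X_sub_C]
    simpa [frobPoly, Polynomial.map_sub, Polynomial.map_add, Polynomial.map_mul,
      Polynomial.map_pow] using hpoly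
  obtain ⟨hsum, -⟩ := coeff_quadratic_eq hpoly'
  rw [Multiset.insert_eq_cons, Multiset.sum_cons, Multiset.sum_singleton, mul_add, hsum, ha]

/-- **lang.S28 (`ReciprocityGLn` formulation) from the printed statement, Galois form on the
target's carrier.**  The printed Cor. 7.1.12 of Allen–Calegari–Caraiani–Gee–Helm–Le Hung–Newton–
Scholze–Taylor–Thorne (*Suppose that `F` is a CM field and that `R = (M, S, {Q_v(X)}, {r_λ},
{{0,1}})` is a strongly irreducible rank `2` very weakly compatible system of `l`-adic
representations of `G_F`. If `m` is a non-negative integer, then there exists a finite Galois CM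
extension `F'/F` such that the weakly compatible system `Symm^m R|_{G_{F'}}` is automorphic*), for
`m = 1` and `R = R_E` of an elliptic curve without geometric CM over a CM field — read, as the
explicit **hypothesis** `h`, on the tree's objects: over some finite extension `L/K` with `L` CM,
`E ⊗ L` is cuspidal-Tate-automorphic (`IsCuspidalTateAutomorphic`, the `K = F'` clause of the named
fact `exists_isCMField_forall_isSolvable_isTateAutomorphic`; "Galois" dropped) — implies the
accepted `Literature.NumberTheory.Automorphic.potentiallyModular_ellipticCurve_CM`: apply `h` to
`E ⊗ K` (elliptic since `Δ ≠ 0`), move to the integral model `E ⊗ 𝓞 L`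
(`baseChange_baseChange_eq_baseChange_ringOfIntegers`, `baseChange_ringOfIntegers_Δ_ne_zero`) and
use `exists_hasWeightZero_frobTraceAt_of_isCuspidalTateAutomorphic`.  This is how the source reads
Thm. 1.0.1 off Cor. 7.1.12 (§7.1: `R_E` has `Q_v = X² - a_v X + q_v`, `a_v = q_v + 1 - #Ẽ(k_v)`).
[cite: ACCGHLNSTT2023, Thm. 1.0.1 (non-CM case), via Cor. 7.1.12 (m = 1, R = R_E) and §7.1] -/
theorem potentiallyModular_ellipticCurve_CM_of_isCuspidalTateAutomorphic
    (h : ∀ {K : Type} [Field K] [NumberField K] [IsCMField K] (W : WeierstrassCurve K)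
      [W.IsElliptic], ¬ W.HasCM →
        ∃ (L : Type) (_ : Field L) (_ : NumberField L) (_ : Algebra K L),
          IsCMField L ∧ (W.baseChange L).IsCuspidalTateAutomorphic) :
    potentiallyModular_ellipticCurve_CM := by
  intro K _ _ _ E hΔ hCM
  haveI : (E.baseChange K).IsElliptic :=
    ⟨isUnit_iff_ne_zero.mpr (by
      rw [WeierstrassCurve.baseChange, WeierstrassCurve.map_Δ]
      exact RingOfIntegers.coe_ne_zero_iff.mpr hΔ)⟩
  obtain ⟨L, _, _, _, hCML, hA⟩ := h (E.baseChange K) hCM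
  rw [baseChange_baseChange_eq_baseChange_ringOfIntegers] at hA
  obtain ⟨hL, π, h0, hev⟩ := exists_hasWeightZero_frobTraceAt_of_isCuspidalTateAutomorphic
    (baseChange_ringOfIntegers_Δ_ne_zero L hΔ) hA
  exact ⟨L, _, _, _, hCML, hL, π, h0, hev⟩

/-- **lang.S28 (`ReciprocityGLn` formulation) from the named fact of
`Sweep1PotentialModularitySolubleDescent`.**  The strong form with soluble descent
`Literature.NumberTheory.Automorphic.exists_isCMField_forall_isSolvable_isTateAutomorphic`
(Allen et al. 2023, Cor. 7.1.12 for `m = 1`, `R = R_E`, with Prop. 6.5.13 (2)) implies the accepted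
`Literature.NumberTheory.Automorphic.potentiallyModular_ellipticCurve_CM`: take the soluble-index
subfield `K = F'` itself (`Gal(F'/F')` trivial: Mathlib `AlgEquiv.subsingleton_left`,
`isSolvable_of_subsingleton`, as in `exists_isCMField_isTateAutomorphic_of_forall_isSolvable`) and
apply `potentiallyModular_ellipticCurve_CM_of_isCuspidalTateAutomorphic`.  Hence, once that fact is
discharged, `potentiallyModular_ellipticCurve_CM_holds` is this theorem applied to its `_holds`.
[cite: ACCGHLNSTT2023, Thm. 1.0.1 (non-CM case), via Cor. 7.1.12 (m = 1, R = R_E)] -/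
theorem potentiallyModular_ellipticCurve_CM_of_forall_isSolvable_isTateAutomorphic
    (h : exists_isCMField_forall_isSolvable_isTateAutomorphic) :
    potentiallyModular_ellipticCurve_CM := by
  refine potentiallyModular_ellipticCurve_CM_of_isCuspidalTateAutomorphic ?_
  intro K _ _ _ W _ hW
  obtain ⟨F', hF', hNF', hAlg, hCM, -, hsol⟩ := h W hW
  refine ⟨F', hF', hNF', hAlg, hCM, ?_⟩
  letI : Algebra F' F' := Algebra.id F'
  have hs : IsSolvable (F' ≃ₐ[F'] F') := inferInstance
  exact (hsol F' hs).2

/-- **Assembly of the split of `potentiallyModular_ellipticCurve_CM`** (lang.S28; budget-capped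
fact, librarian `fact-decompose`, human ruling 2026-08-16). The source reads Thm. 1.0.1 off
Cor. 7.1.12 (`m = 1`, `R = R_E`) in one sentence, and the tree proves that sentence in full (this
file: the Frobenius-trace bridge, the minimal-model comparison, the reduction); what remains is
Cor. 7.1.12 for `R_E` itself with soluble descent, the named fact
`exists_isCMField_forall_isSolvable_isTateAutomorphic` (`Sweep1PotentialModularitySolubleDescent`,
Allen et al. 2023, Cor. 7.1.12 with Prop. 6.5.13 (2)) — the single child of the split, itself
theory-sized (the ten-author potential automorphy machine: Thm. 6.1.1 and §7). The glue is
`potentiallyModular_ellipticCurve_CM_of_forall_isSolvable_isTateAutomorphic`.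
[cite: ACCGHLNSTT2023, Thm. 1.0.1 (non-CM case), via Cor. 7.1.12 (m = 1, R = R_E) and Prop. 6.5.13 (2)] -/
theorem potentiallyModular_ellipticCurve_CM_holds_of :
    exists_isCMField_forall_isSolvable_isTateAutomorphic → potentiallyModular_ellipticCurve_CM :=
  fun h => potentiallyModular_ellipticCurve_CM_of_forall_isSolvable_isTateAutomorphic h

end Assembly

end Literature.NumberTheory.Automorphic
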